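import Literature.Topology.FourManifolds.SurfaceGroupEpimorphisms
import Literature.Topology.FourManifolds.SurfaceGroupHandleMoves
import Literature.GroupTheory.CombinatorialGroupTheory.NielsenGeneratingTuplesNormalForm
import Mathlib.Tactic.Group
import HarnessLib

/-!
# Epimorphisms `S_g ↠ F_g` killing a cut system are standard; reduction of
# Grigorchuk–Kurchanov's strong equivalence to the existence of a killed cut system

Topic `Literature/Topology/FourManifolds`; theorems (and two auxiliary definitions) over
`SurfaceGroupEpimorphisms.lean` (the named fact `GrigorchukKurchanov1990_stronglyEquivalent`),
`SurfaceGroupHandleMoves.lean` (the relator-preserving lifts `flipEquiv`, `slideEquiv`,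
`coslideEquiv` of Nielsen's generators) and the tree's Nielsen theory
(`Literature/GroupTheory/CombinatorialGroupTheory/Nielsen*.lean`).  This is the SECOND HALF of
the proof of Grigorchuk–Kurchanov's theorem (Mat. Zametki 48 (1990); orientable case, rank `g`):
once an epimorphism `φ : S_g ↠ F_g` kills the cut system `a₀, …, a_{g-1}` up to an automorphism
of `S_g` (the Nielsen–Zieschang cancellation argument for the quadratic relator, Zieschang 1964 /
Zieschang–Vogt–Coldewey §5.2 and E 5.4 — the first half, not in this file), it is the standard
projection up to an automorphism of `S_g`:

* `SurfaceGroup.handlebodyProj g : S_g →* F_g` — the **handlebody projection** `ν`: `aᵢ ↦ 1`,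
  `bᵢ ↦ xᵢ` (surjective, split by `xᵢ ↦ bᵢ`);
* `SurfaceGroup.liftable g` — the subgroup of `Aut F_g` of automorphisms `θ` that LIFT along
  `ν` (`ν ∘ δ = θ ∘ ν` for some `δ ∈ Aut S_g`), and `liftable_eq_top` — **every automorphism of
  `F_g` lifts** (Griffiths 1964; Zieschang 1964: the handlebody group maps onto `Aut π₁(H_g)`):
  Nielsen's generators `xₖ ↦ xₖ⁻¹`, `xₖ ↦ xₖxₗ` lift to `flipEquiv`, `slideEquiv`/`coslideEquiv`,
  and they generate `Aut F_g` (`nielsenSubgroup_fin_eq_top`, Nielsen 1924);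
* `SurfaceGroup.exists_mulEquiv_comp_eq_handlebodyProj` — **an epimorphism `φ : S_g ↠ F_g` with
  `φ(aᵢ) = 1` for all `i` is `ν` up to an automorphism of `S_g`**: `φ = θ ∘ ν` with
  `θ = (φ bᵢ)ᵢ` an AUTOMORPHISM because a generating `g`-tuple of `F_g` is Nielsen equivalent to
  the basis (`exists_mulAut_lift_apply_eq_basis`, Lyndon–Schupp I Prop. 2.7), then lift `θ⁻¹`;
* `stronglyEquivalent_of_forall_exists_apply_a_eq_one` — **reduction**: if every epimorphism
  `S_g ↠ F_g` kills `γ(a₀), …, γ(a_{g-1})` for some `γ ∈ Aut S_g`, then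
  `GrigorchukKurchanov1990_stronglyEquivalent` holds.

## References

* R. I. Grigorchuk, P. F. Kurchanov, *Classification of epimorphisms from fundamental groups of
  surfaces onto free groups*, Mat. Zametki 48 (1990) 26–35 = Math. Notes 48 (1990) 736–742
  (main theorem, orientable case). [GrigorchukKurchanov1990]
* H. B. Griffiths, *Automorphisms of a 3-dimensional handlebody*, Abh. Math. Sem. Univ. Hamburg
  26 (1964) 191–210. [GriffithsHB1964Handlebody]
* H. Zieschang, *Alternierende Produkte in freien Gruppen*, Abh. Math. Sem. Univ. Hamburg 27
  (1964) 13–31. [Zieschang1964]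
* H. Zieschang, E. Vogt, H.-D. Coldewey, *Surfaces and Planar Discontinuous Groups*, LNM 835
  (1980), §5.2 (binary products), E 5.4. [ZieschangVogtColdewey1980]
* R. C. Lyndon, P. E. Schupp, *Combinatorial Group Theory* (2001), Ch. I Prop. 2.7, Prop. 4.1.
  [LyndonSchupp2001]
-/

noncomputable section

namespace Literature.Topology.FourManifolds

open Literature.GroupTheory.CombinatorialGroupTheory

namespace SurfaceGroup

variable {g : ℕ}

/-! ## The handlebody projection `ν : S_g ↠ F_g` -/

/-- Generator images of the handlebody projection: `aᵢ ↦ 1`, `bᵢ ↦ xᵢ`. [folklore] -/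
def handlebodyProjGens (g : ℕ) (p : surfaceGen g) : FreeGroup (Fin g) :=
  bif p.2 then FreeGroup.of p.1 else 1

/-- `aᵢ ↦ 1`. [folklore] -/
@[simp] theorem handlebodyProjGens_false (i : Fin g) : handlebodyProjGens g (i, false) = 1 := rfl

/-- `bᵢ ↦ xᵢ`. [folklore] -/
@[simp] theorem handlebodyProjGens_true (i : Fin g) :
    handlebodyProjGens g (i, true) = FreeGroup.of i := rfl

/-- **The handlebody projection** `ν : S_g →* F_g`, `aᵢ ↦ 1`, `bᵢ ↦ xᵢ` (the map induced on `π₁` by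
the inclusion of `Σ_g` as the boundary of a handlebody whose meridians are the `aᵢ`; the relator
dies because every handle is cut). [folklore] -/
def handlebodyProj (g : ℕ) : SurfaceGroup g →* FreeGroup (Fin g) :=
  homOfGens (handlebodyProjGens g) (by
    rw [← lift_surfaceRelator]
    exact lift_surfaceRelator_eq_one_of_hits _ fun j => Or.inl rfl)

/-- `ν` on a generator. [folklore] -/
theorem handlebodyProj_of (p : surfaceGen g) :
    handlebodyProj g (PresentedGroup.of p) = handlebodyProjGens g p :=
  homOfGens_of _ _ p

/-- `ν(aᵢ) = 1`. [folklore] -/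
@[simp] theorem handlebodyProj_a (i : Fin g) : handlebodyProj g (a i) = 1 :=
  homOfGens_a _ _ i

/-- `ν(bᵢ) = xᵢ`. [folklore] -/
@[simp] theorem handlebodyProj_b (i : Fin g) : handlebodyProj g (b i) = FreeGroup.of i :=
  homOfGens_b _ _ i

/-- `ν` kills every middle block `mid k l = ∏_{k<h<l} [a_h, b_h]`. [folklore] -/
@[simp] theorem handlebodyProj_mid (k l : ℕ) : handlebodyProj g (mid k l) = 1 :=
  map_mid_eq_one _ k l fun j => Or.inl (handlebodyProj_a j)

/-- The section `xᵢ ↦ bᵢ` of `ν`. [folklore] -/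
def handlebodySection (g : ℕ) : FreeGroup (Fin g) →* SurfaceGroup g :=
  FreeGroup.lift fun i => b i

/-- `ν ∘ (xᵢ ↦ bᵢ) = id`. [folklore] -/
theorem handlebodyProj_comp_handlebodySection :
    (handlebodyProj g).comp (handlebodySection g) = MonoidHom.id _ :=
  FreeGroup.ext_hom _ _ fun i => by simp [handlebodySection]

/-- `ν` is split by `xᵢ ↦ bᵢ`. [folklore] -/
theorem handlebodyProj_handlebodySection (x : FreeGroup (Fin g)) :
    handlebodyProj g (handlebodySection g x) = x :=
  DFunLike.congr_fun handlebodyProj_comp_handlebodySection x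

/-- `ν` is surjective. [folklore] -/
theorem handlebodyProj_surjective : Function.Surjective (handlebodyProj g) :=
  fun x => ⟨_, handlebodyProj_handlebodySection x⟩

/-! ## Every automorphism of `F_g` lifts along `ν` -/

/-- The subgroup of `Aut F_g` of the automorphisms `θ` that lift along `ν`: `ν ∘ δ = θ ∘ ν` for
some `δ ∈ Aut S_g`. [folklore] -/
def liftable (g : ℕ) : Subgroup (MulAut (FreeGroup (Fin g))) where
  carrier := {θ | ∃ δ : MulAut (SurfaceGroup g), ∀ x, handlebodyProj g (δ x) = θ (handlebodyProj g x)}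
  one_mem' := ⟨1, fun x => by simp⟩
  mul_mem' := by
    rintro θ₁ θ₂ ⟨δ₁, h₁⟩ ⟨δ₂, h₂⟩
    exact ⟨δ₁ * δ₂, fun x => by rw [MulAut.mul_apply, MulAut.mul_apply, h₁, h₂]⟩
  inv_mem' := by
    rintro θ ⟨δ, h⟩
    refine ⟨δ⁻¹, fun x => ?_⟩
    have hx := h (δ⁻¹ x)
    rw [MulAut.apply_inv_self] at hx
    rw [hx, MulAut.inv_apply_self]

/-- Membership in `liftable` is checked on the generators of `S_g`. [folklore] -/
theorem mem_liftable_of_forall_of (θ : MulAut (FreeGroup (Fin g))) (δ : MulAut (SurfaceGroup g))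
    (h : ∀ p : surfaceGen g,
      handlebodyProj g (δ (PresentedGroup.of p)) = θ (handlebodyProjGens g p)) :
    θ ∈ liftable g := by
  refine ⟨δ, fun x => ?_⟩
  have H : (handlebodyProj g).comp δ.toMonoidHom = θ.toMonoidHom.comp (handlebodyProj g) :=
    PresentedGroup.ext fun p => by simpa [handlebodyProj_of] using h p
  simpa using DFunLike.congr_fun H x

/-- **Nielsen's inversion `xₖ ↦ xₖ⁻¹` lifts** to the inversion move `flipEquiv k`
(`a_k ↦ b_k a_k⁻¹ b_k⁻¹`, `b_k ↦ b_k a_k b_k⁻²`). [cite: GriffithsHB1964Handlebody] -/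
theorem nielsenAlpha_mem_liftable (k : Fin g) : nielsenAlpha k ∈ liftable g := by
  refine mem_liftable_of_forall_of _ (flipEquiv k) ?_
  rintro ⟨i, _ | _⟩
  · by_cases hi : i = k
    · subst hi
      rw [← a_def, flipEquiv_a_self]
      simp [map_mul, map_inv]
    · rw [← a_def, flipEquiv_a_of_ne hi]
      simp
  · by_cases hi : i = k
    · subst hi
      rw [← b_def, flipEquiv_b_self]
      simp [map_mul, map_inv]
    · rw [← b_def, flipEquiv_b_of_ne hi]
      simp [nielsenAlpha_of_ne hi]

/-- **Nielsen's transvection `xₖ ↦ xₖ xₗ` (`k < l`) lifts** to the handle slide `slideEquiv`.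
[cite: GriffithsHB1964Handlebody] -/
theorem nielsenBeta_mem_liftable_of_lt {k l : Fin g} (hkl : k < l) :
    nielsenBeta k l hkl.ne ∈ liftable g := by
  refine mem_liftable_of_forall_of _ (slideEquiv hkl) ?_
  rintro ⟨i, s⟩
  rw [slideEquiv_of]
  by_cases hik : i = k
  · subst hik
    cases s
    · rw [blockGens_k_false]
      simp [HandleWords.slideA, map_mul, map_inv]
    · rw [blockGens_k_true]
      simp only [HandleWords.slideB, map_mul, map_inv, handlebodyProj_a, handlebodyProj_b,
        handlebodyProj_mid, handlebodyProjGens_true, nielsenBeta_of_self]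
      group
  by_cases hil : i = l
  · subst hil
    cases s
    · rw [blockGens_l_false hkl]
      simp only [HandleWords.slideC, map_mul, map_inv, handlebodyProj_a, handlebodyProj_b,
        handlebodyProj_mid, handlebodyProjGens_false, map_one]
      group
    · rw [blockGens_l_true hkl]
      simp only [HandleWords.slideD, map_mul, map_inv, handlebodyProj_a, handlebodyProj_b,
        handlebodyProj_mid, handlebodyProjGens_true, nielsenBeta_of_ne hkl.ne hkl.ne']
      group
  · rw [blockGens_of_ne _ _ _ _ hik hil, handlebodyProj_of]
    cases s
    · simp
    · simp [nielsenBeta_of_ne hkl.ne hik]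

/-- **Nielsen's transvection `xₗ ↦ xₗ xₖ` (`k < l`) lifts** to the handle slide `coslideEquiv`.
[cite: GriffithsHB1964Handlebody] -/
theorem nielsenBeta_mem_liftable_of_gt {k l : Fin g} (hkl : k < l) :
    nielsenBeta l k hkl.ne' ∈ liftable g := by
  refine mem_liftable_of_forall_of _ (coslideEquiv hkl) ?_
  rintro ⟨i, s⟩
  rw [coslideEquiv_of]
  by_cases hik : i = k
  · subst hik
    cases s
    · rw [blockGens_k_false]
      simp only [HandleWords.coslideA, map_mul, map_inv, handlebodyProj_a, handlebodyProj_b,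
        handlebodyProj_mid, handlebodyProjGens_false, map_one]
      group
    · rw [blockGens_k_true]
      simp only [HandleWords.coslideB, map_mul, map_inv, handlebodyProj_a, handlebodyProj_b,
        handlebodyProj_mid, handlebodyProjGens_true, nielsenBeta_of_ne hkl.ne' hkl.ne]
      group
  by_cases hil : i = l
  · subst hil
    cases s
    · rw [blockGens_l_false hkl]
      simp only [HandleWords.coslideC, map_mul, map_inv, handlebodyProj_a, handlebodyProj_b,
        handlebodyProj_mid, handlebodyProjGens_false, map_one]
      group
    · rw [blockGens_l_true hkl]
      simp only [HandleWords.coslideD, map_mul, map_inv, handlebodyProj_a, handlebodyProj_b,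
        handlebodyProj_mid, handlebodyProjGens_true, nielsenBeta_of_self]
      group
  · rw [blockGens_of_ne _ _ _ _ hik hil, handlebodyProj_of]
    cases s
    · simp
    · simp [nielsenBeta_of_ne hkl.ne' hil]

/-- **Every automorphism of `F_g` lifts along the handlebody projection** (Griffiths 1964;
Zieschang 1964): the liftable automorphisms form a subgroup containing Nielsen's generators of
`Aut F_g` (Nielsen 1924, `nielsenSubgroup_fin_eq_top`). [cite: GriffithsHB1964Handlebody]
[cite: LyndonSchupp2001, Ch. I Prop. 4.1] -/
theorem liftable_eq_top : liftable g = ⊤ := by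
  rw [eq_top_iff, ← closure_elementaryNielsen_fin_eq_top, Subgroup.closure_le]
  rintro θ (⟨k, rfl⟩ | ⟨k, l, hkl, rfl⟩)
  · exact nielsenAlpha_mem_liftable k
  · rcases lt_or_gt_of_ne hkl with h | h
    · exact nielsenBeta_mem_liftable_of_lt h
    · exact nielsenBeta_mem_liftable_of_gt h

/-- **Every automorphism `θ` of `F_g` lifts**: `ν ∘ δ = θ ∘ ν` for some `δ ∈ Aut S_g`.
[cite: GriffithsHB1964Handlebody] -/
theorem exists_mulAut_handlebodyProj_apply (θ : MulAut (FreeGroup (Fin g))) :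
    ∃ δ : MulAut (SurfaceGroup g), ∀ x, handlebodyProj g (δ x) = θ (handlebodyProj g x) := by
  have h : θ ∈ liftable g := by rw [liftable_eq_top]; exact Subgroup.mem_top θ
  exact h

/-! ## Epimorphisms killing the cut system `{aᵢ}` are standard -/

/-- **An epimorphism `φ : S_g ↠ F_g` killing every `aᵢ` is the handlebody projection up to an
automorphism of `S_g`.**  Proof: `φ = θ ∘ ν` with `θ = û`, `u = (φ bᵢ)ᵢ` a generating
`g`-tuple of `F_g`; by the normal form of generating tuples (Lyndon–Schupp I Prop. 2.7) `û ∘ ε = id`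
for some `ε ∈ Aut F_g`, and `ε` lifts to `δ ∈ Aut S_g` (`exists_mulAut_handlebodyProj_apply`), so
`φ ∘ δ = û ∘ ν ∘ δ = û ∘ ε ∘ ν = ν`. [cite: LyndonSchupp2001, Ch. I Prop. 2.7]
[cite: GriffithsHB1964Handlebody] -/
theorem exists_mulEquiv_comp_eq_handlebodyProj (φ : SurfaceGroup g →* FreeGroup (Fin g))
    (hφ : Function.Surjective φ) (ha : ∀ i, φ (a i) = 1) :
    ∃ γ : SurfaceGroup g ≃* SurfaceGroup g, φ.comp γ.toMonoidHom = handlebodyProj g := by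
  set u : Fin g → FreeGroup (Fin g) := fun i => φ (b i) with hu
  have hfac : ∀ y, φ y = FreeGroup.lift u (handlebodyProj g y) := by
    intro y
    have H : φ = (FreeGroup.lift u).comp (handlebodyProj g) := by
      refine PresentedGroup.ext fun p => ?_
      obtain ⟨i, _ | _⟩ := p
      · rw [← a_def]; simp [ha i]
      · rw [← b_def]; simp [hu]
    exact DFunLike.congr_fun H y
  have hgen : Subgroup.closure (Set.range u) = ⊤ := by
    rw [← FreeGroup.range_lift_eq_closure, eq_top_iff]
    rintro x -
    obtain ⟨y, rfl⟩ := hφ x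
    exact ⟨handlebodyProj g y, (hfac y).symm⟩
  obtain ⟨ε, hε, -⟩ := exists_mulAut_lift_apply_eq_basis u hgen id Function.injective_id
  have hid : ∀ y, FreeGroup.lift u (ε y) = y := by
    intro y
    have H : (FreeGroup.lift u).comp ε.toMonoidHom = MonoidHom.id _ :=
      FreeGroup.ext_hom _ _ fun i => by simpa using hε i
    exact DFunLike.congr_fun H y
  obtain ⟨δ, hδ⟩ := exists_mulAut_handlebodyProj_apply (g := g) ε
  refine ⟨δ, MonoidHom.ext fun y => ?_⟩
  rw [MonoidHom.comp_apply, MulEquiv.coe_toMonoidHom, hfac, hδ, hid]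

/-! ## Reduction of strong equivalence to killing a cut system -/

/-- **Reduction.**  If every epimorphism `φ : S_g ↠ F_g` kills `γ(a₀), …, γ(a_{g-1})` for some
automorphism `γ` of `S_g` (equivalently: `ker φ` contains the image of the standard cut system
under an automorphism — the content of the Nielsen–Zieschang cancellation argument, Zieschang
1964 / Zieschang–Vogt–Coldewey §5.2, E 5.4), then any two epimorphisms `α, β : S_g ↠ F_g` are
strongly equivalent, `α ∘ γ = β` (Grigorchuk–Kurchanov 1990, orientable case, rank `g`): both
`α ∘ γ_α` and `β ∘ γ_β` kill the `aᵢ`, hence both are `ν` up to automorphisms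
(`exists_mulEquiv_comp_eq_handlebodyProj`). [cite: GrigorchukKurchanov1990, main theorem (orientable case, r = g)]
[cite: ZieschangVogtColdewey1980, §5.2 and E 5.4] -/
theorem stronglyEquivalent_of_forall_exists_apply_a_eq_one
    (H : ∀ (g : ℕ) (φ : SurfaceGroup g →* FreeGroup (Fin g)), Function.Surjective φ →
      ∃ γ : SurfaceGroup g ≃* SurfaceGroup g, ∀ i, φ (γ (a i)) = 1) :
    GrigorchukKurchanov1990_stronglyEquivalent := by
  intro g α β hα hβ
  obtain ⟨γ₁, h₁⟩ := H g α hα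
  obtain ⟨γ₂, h₂⟩ := H g β hβ
  obtain ⟨δ₁, e₁⟩ := exists_mulEquiv_comp_eq_handlebodyProj (α.comp γ₁.toMonoidHom)
    (hα.comp γ₁.surjective) (fun i => by simpa using h₁ i)
  obtain ⟨δ₂, e₂⟩ := exists_mulEquiv_comp_eq_handlebodyProj (β.comp γ₂.toMonoidHom)
    (hβ.comp γ₂.surjective) (fun i => by simpa using h₂ i)
  -- `α γ₁ δ₁ = ν = β γ₂ δ₂`, so `α (γ₁ δ₁ δ₂⁻¹ γ₂⁻¹) = β`
  refine ⟨((γ₂.symm.trans δ₂.symm).trans δ₁).trans γ₁, MonoidHom.ext fun x => ?_⟩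
  have f₁ := DFunLike.congr_fun e₁ (δ₂.symm (γ₂.symm x))
  have f₂ := DFunLike.congr_fun e₂ (δ₂.symm (γ₂.symm x))
  simp only [MonoidHom.coe_comp, MulEquiv.coe_toMonoidHom, Function.comp_apply,
    MulEquiv.apply_symm_apply] at f₁ f₂
  simp only [MonoidHom.coe_comp, MulEquiv.coe_toMonoidHom, Function.comp_apply,
    MulEquiv.trans_apply]
  rw [f₁, ← f₂]

end SurfaceGroup

end Literature.Topology.FourManifolds

end
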